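import Literature.NumberTheory.QuadraticFields.InfrastructureGiantStep
import HarnessLib

/-!
# Composition of ideal-shaped quotients (Gauss–Dirichlet composition) and the general giant step

Topic `NumberTheory/QuadraticFields`; continues `QuadraticIrrationalDuplication.lean` (the case
`x = y`) and `InfrastructureGiantStep.lean`. Theorem-and-definition file (no named facts). For two
ideal-shaped quotients `x = (b₁, 2a₁)`, `y = (b₂, 2a₂)` of the same discriminant `D` put
`s = (b₁ + b₂)/2`, `g = gcd(a₁, a₂, s) = ua₁ + va₂ + ws`, `Aᵢ = aᵢ/g`, `S = s/g`,
`cᵢ = (bᵢ² − D)/4aᵢ`, and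

  `compose x y = (B, 2A₁A₂)`, `B = uA₁b₂ + vA₂b₁ + w(Sb₁ − 2A₁c₁)`

(Jozsa 2003, §7.1 Prop. 34 "`I₃ = I₁·I₂` with `a₃ = a₁a₂/k²`", where his `k` is our `g`; Cohen,
*A Course in Computational Algebraic Number Theory*, Alg. 5.4.7; Jacobson–Williams §5.4). We prove

* `latZ_mul_latZ_compose` — **the lattice identity** `L(x)·L(y) = span{2g·Q₃, 2g(B + √D)}`,
  `L(x) = Qℤ + (P + √D)ℤ` (`x` primitive), by the explicit change of generators
  `Q₁Q₂ = g·G₁`, `Q₁(b₂+√D) = (vm + wc₂)G₁ + A₁G₂`, `Q₂(b₁+√D) = (wc₁ − um)G₁ + A₂G₂`,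
  `(b₁+√D)(b₂+√D) = −(uc₂ + vc₁)G₁ + S·G₂` (`2m = b₂ − b₁`) and its inverse;
* `isIdealShaped_compose` (`B² − D = 4A₁A₂(k₁₂k₂₁ + g(uc₂ + vc₁))`);
* `mem_jmod_compose_iff` — for cycle elements, **`J(compose x_{n₁} x_{n₂}) = g Π_{n₁} Π_{n₂} · O`**;
* **`giant_step_compose`** — `reduce (compose x_{n₁} x_{n₂}) = x_m`, `1 ≤ m ≤ p`, with
  `Π_m εʲ = |μ| · g · Π_{n₁} Π_{n₂}`: the distances add up to the bounded defect `log(|μ| g)`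
  (Jozsa Prop. 35 / Jacobson–Williams (7.28)).

## References

* R. Jozsa, arXiv:quant-ph/0302134 (2003), §7.1 Props. 34–35. [Jozsa2003]
* H. Cohen, *A Course in Computational Algebraic Number Theory*, GTM 138, Springer (1993), §5.4.2
  Alg. 5.4.7. [Cohen1993]
* M. J. Jacobson, Jr., H. C. Williams, *Solving the Pell Equation*, Springer (2009), §5.4, §7.4 (7.28).
  [JacobsonWilliams2008]
-/

noncomputable section

open scoped Classical Pointwise

namespace Literature.NumberTheory.QuadraticFields

namespace QuadIrr

variable {D : ℕ}

/-! ### Composition data -/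

/-- `s = (b₁ + b₂)/2`. [cite: Cohen1993, Alg. 5.4.7 step 2] -/
def compS (x y : QuadIrr D) : ℤ := (x.P + y.P) / 2

/-- `g = gcd(a₁, a₂, s)`. [cite: Jozsa2003, §7.1 Prop. 34 (k = gcd(a₁, a₂, (b₁+b₂)/2))] -/
def compG (x y : QuadIrr D) : ℤ := Int.gcd (Int.gcd (fa x) (fa y)) (compS x y)

/-- Bézout coefficient `u` of `ua₁ + va₂ + ws = g`. [cite: Cohen1993, Alg. 5.4.7 steps 3–4] -/
def compU (x y : QuadIrr D) : ℤ := Int.gcdA (Int.gcd (fa x) (fa y)) (compS x y) * Int.gcdA (fa x) (fa y)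
/-- Bézout coefficient `v` of `ua₁ + va₂ + ws = g`. [cite: Cohen1993, Alg. 5.4.7 steps 3–4] -/
def compV (x y : QuadIrr D) : ℤ := Int.gcdA (Int.gcd (fa x) (fa y)) (compS x y) * Int.gcdB (fa x) (fa y)
/-- Bézout coefficient `w` of `ua₁ + va₂ + ws = g`. [cite: Cohen1993, Alg. 5.4.7 steps 3–4] -/
def compW (x y : QuadIrr D) : ℤ := Int.gcdB (Int.gcd (fa x) (fa y)) (compS x y)

/-- **Composition**: `compose x y = (B, 2A₁A₂)`, `Aᵢ = aᵢ/g`,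
`B = uA₁b₂ + vA₂b₁ + w(Sb₁ − 2A₁c₁)` (`S = s/g`). [cite: Jozsa2003, §7.1 Prop. 34] -/
def compose (x y : QuadIrr D) : QuadIrr D :=
  ⟨compU x y * (fa x / compG x y) * y.P + compV x y * (fa y / compG x y) * x.P +
      compW x y * (compS x y / compG x y * x.P - 2 * (fa x / compG x y) * fc x),
    2 * (fa x / compG x y) * (fa y / compG x y)⟩

/-- Bézout: `ua₁ + va₂ + ws = g`. [folklore] -/
theorem compose_bezout (x y : QuadIrr D) :
    compU x y * fa x + compV x y * fa y + compW x y * compS x y = compG x y := by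
  unfold compU compV compW compG
  have h1 : (Int.gcd (fa x) (fa y) : ℤ) = fa x * Int.gcdA (fa x) (fa y) + fa y * Int.gcdB (fa x) (fa y) :=
    Int.gcd_eq_gcd_ab _ _
  have h2 := Int.gcd_eq_gcd_ab (Int.gcd (fa x) (fa y) : ℤ) (compS x y)
  linear_combination (-1 : ℤ) * h2 - Int.gcdA (Int.gcd (fa x) (fa y) : ℤ) (compS x y) * h1

/-- `g > 0` when `a₁ ≠ 0`. [folklore] -/
theorem compG_pos {x y : QuadIrr D} (hx : x.IsIdealShaped) : 0 < compG x y := by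
  unfold compG
  have ha : fa x ≠ 0 := by have := Q_eq_two_mul_fa hx; have := hx.1; omega
  have h1 : Int.gcd (fa x) (fa y) ≠ 0 := fun h => ha (Int.gcd_eq_zero_iff.mp h).1
  have h1' : ((Int.gcd (fa x) (fa y) : ℕ) : ℤ) ≠ 0 := by exact_mod_cast h1
  exact_mod_cast Int.gcd_pos_of_ne_zero_left (compS x y) h1'

/-- Ideal-shaped quotients of one discriminant have `b₁ ≡ b₂ (mod 2)` (`bᵢ² ≡ D (mod 4)`). [folklore] -/
theorem two_dvd_sub_of_isIdealShaped {x y : QuadIrr D} (hx : x.IsIdealShaped) (hy : y.IsIdealShaped) :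
    2 ∣ y.P - x.P := by
  have h1 := sq_sub_eq hx
  have h2 := sq_sub_eq hy
  have h4 : (2 : ℤ) ∣ (y.P - x.P) * (y.P + x.P) :=
    ⟨2 * (fa y * fc y - fa x * fc x), by linear_combination h2 - h1⟩
  rcases Int.prime_two.dvd_mul.mp h4 with h | ⟨k, hk⟩
  · exact h
  · exact ⟨k - x.P, by linarith⟩

/-- `2s = b₁ + b₂`. [folklore] -/
theorem two_mul_compS {x y : QuadIrr D} (hx : x.IsIdealShaped) (hy : y.IsIdealShaped) :
    2 * compS x y = x.P + y.P := by
  obtain ⟨m, hm⟩ := two_dvd_sub_of_isIdealShaped hx hy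
  unfold compS; omega

/-- `k₂₂ = −(uc₂ + vc₁)`, the `G₁`-coefficient of `(b₁+√D)(b₂+√D)`. [folklore] -/
def compK (x y : QuadIrr D) : ℤ := -(compU x y * fc y + compV x y * fc x)

/-- Unfolding `compK`. [folklore] -/
theorem compK_def (x y : QuadIrr D) : compK x y = -(compU x y * fc y + compV x y * fc x) := rfl

/-- The data of the composition identities. [cite: Jozsa2003, §7.1 Prop. 34] -/
structure CompData (x y : QuadIrr D) where
  /-- `A₁ = a₁/g` -/ A₁ : ℤ
  /-- `A₂ = a₂/g` -/ A₂ : ℤ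
  /-- `S = s/g` -/ S : ℤ
  /-- `m = (b₂ − b₁)/2` -/ m : ℤ
  /-- primitivity Bézout -/ α : ℤ
  /-- primitivity Bézout -/ β : ℤ
  /-- primitivity Bézout -/ γ : ℤ
  ha₁ : fa x = compG x y * A₁
  ha₂ : fa y = compG x y * A₂
  hS : compS x y = compG x y * S
  hm : y.P = x.P + 2 * m
  hprim : α * fa x + β * x.P + γ * fc x = 1

/-- Ideal-shaped data with `x` primitive admits composition data. [cite: Jozsa2003, §7.1 Prop. 34] -/
theorem exists_compData {x y : QuadIrr D} (hx : x.IsIdealShaped) (hy : y.IsIdealShaped) (hp : x.IsPrimitive) :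
    Nonempty (CompData x y) := by
  have hg1 : (compG x y : ℤ) ∣ Int.gcd (fa x) (fa y) := Int.gcd_dvd_left _ _
  obtain ⟨A₁, hA₁⟩ := hg1.trans (Int.gcd_dvd_left (fa x) (fa y))
  obtain ⟨A₂, hA₂⟩ := hg1.trans (Int.gcd_dvd_right (fa x) (fa y))
  obtain ⟨S, hS⟩ := (Int.gcd_dvd_right (Int.gcd (fa x) (fa y) : ℤ) (compS x y) : (compG x y : ℤ) ∣ compS x y)
  obtain ⟨m, hm⟩ := two_dvd_sub_of_isIdealShaped hx hy
  -- primitivity: `gcd(gcd(a, b), c) = 1`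
  have h0 : (Int.gcd (fa x) x.P : ℤ) = fa x * Int.gcdA (fa x) x.P + x.P * Int.gcdB (fa x) x.P :=
    Int.gcd_eq_gcd_ab _ _
  have h1 := Int.gcd_eq_gcd_ab (Int.gcd (fa x) x.P : ℤ) (fc x)
  have hp1 : (Int.gcd (Int.gcd (fa x) x.P : ℤ) (fc x) : ℤ) = 1 := by exact_mod_cast hp
  refine ⟨⟨A₁, A₂, S, m, Int.gcdA (Int.gcd (fa x) x.P : ℤ) (fc x) * Int.gcdA (fa x) x.P,
    Int.gcdA (Int.gcd (fa x) x.P : ℤ) (fc x) * Int.gcdB (fa x) x.P,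
    Int.gcdB (Int.gcd (fa x) x.P : ℤ) (fc x), hA₁, hA₂, hS, by omega, ?_⟩⟩
  linear_combination (-1 : ℤ) * h1 + hp1 - Int.gcdA (Int.gcd (fa x) x.P : ℤ) (fc x) * h0

namespace CompData

variable {x y : QuadIrr D} (hx : x.IsIdealShaped) (hy : y.IsIdealShaped) (d : CompData x y)
include hx hy

omit hy in
/-- `A₁ > 0`. [folklore] -/
theorem A₁_pos : 0 < d.A₁ := by
  have h := d.ha₁
  have ha : 0 < fa x := by have := Q_eq_two_mul_fa hx; have := hx.1; omega
  have hg := compG_pos (y := y) hx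
  rw [h] at ha
  exact pos_of_mul_pos_right ha hg.le

/-- `A₂ > 0`. [folklore] -/
theorem A₂_pos : 0 < d.A₂ := by
  have h := d.ha₂
  have ha : 0 < fa y := by have := Q_eq_two_mul_fa hy; have := hy.1; omega
  have hg := compG_pos (y := y) hx
  rw [h] at ha
  exact pos_of_mul_pos_right ha hg.le

omit hy in
/-- `uA₁ + vA₂ + wS = 1`. [folklore] -/
theorem bezout₁ : compU x y * d.A₁ + compV x y * d.A₂ + compW x y * d.S = 1 := by
  have h := compose_bezout x y
  rw [d.ha₁, d.ha₂, d.hS] at h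
  have hg := (compG_pos (y := y) hx).ne'
  have : compG x y * (compU x y * d.A₁ + compV x y * d.A₂ + compW x y * d.S) = compG x y * 1 := by
    linear_combination h
  exact mul_left_cancel₀ hg this

/-- `b₁ = gS − m`. [folklore] -/
theorem P_eq : x.P = compG x y * d.S - d.m := by
  have h2 := two_mul_compS hx hy
  rw [d.hS, d.hm] at h2
  omega

/-- `Sm + A₁c₁ = A₂c₂` (from `b₂² − b₁² = 4(a₂c₂ − a₁c₁)`). [folklore] -/
theorem S_mul_m : d.S * d.m + d.A₁ * fc x = d.A₂ * fc y := by
  have h1 := sq_sub_eq hx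
  have h2 := sq_sub_eq hy
  rw [d.ha₁] at h1
  rw [d.ha₂] at h2
  have hP := d.P_eq hx hy
  have hm := d.hm
  have hg := (compG_pos (y := y) hx).ne'
  have key : compG x y * (4 * (d.S * d.m + d.A₁ * fc x)) = compG x y * (4 * (d.A₂ * fc y)) := by
    have e : y.P ^ 2 - x.P ^ 2 = 4 * compG x y * (d.A₂ * fc y) - 4 * compG x y * (d.A₁ * fc x) := by
      linear_combination h2 - h1
    rw [hm, hP] at e
    linear_combination e
  have := mul_left_cancel₀ hg key
  linarith

omit hy in
/-- The composed quotient in terms of the data. [folklore] -/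
theorem compose_P_Q :
    (compose x y).P = compU x y * d.A₁ * y.P + compV x y * d.A₂ * x.P +
        compW x y * (d.S * x.P - 2 * d.A₁ * fc x) ∧
      (compose x y).Q = 2 * d.A₁ * d.A₂ := by
  have hg := (compG_pos (y := y) hx).ne'
  have h1 : fa x / compG x y = d.A₁ := by rw [d.ha₁, mul_comm, Int.mul_ediv_cancel _ hg]
  have h2 : fa y / compG x y = d.A₂ := by rw [d.ha₂, mul_comm, Int.mul_ediv_cancel _ hg]
  have h3 : compS x y / compG x y = d.S := by rw [d.hS, mul_comm, Int.mul_ediv_cancel _ hg]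
  refine ⟨?_, ?_⟩ <;> simp only [compose, h1, h2, h3]

/-- `k₁₂ = vm + wc₂`. [folklore] -/
def k₁₂ : ℤ := compV x y * d.m + compW x y * fc y
/-- `k₂₁ = wc₁ − um`. [folklore] -/
def k₂₁ : ℤ := compW x y * fc x - compU x y * d.m

omit hx hy in
/-- unfolding -/ theorem k₁₂_def : d.k₁₂ = compV x y * d.m + compW x y * fc y := rfl
omit hx hy in
/-- unfolding -/ theorem k₂₁_def : d.k₂₁ = compW x y * fc x - compU x y * d.m := rfl

omit hy in
/-- `B = b₁ − 2A₁k₂₁`. [cite: Cohen1993, Alg. 5.4.7 (B ≡ b₁ mod 2a₁/d)] -/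
theorem compose_P_eq₁ : (compose x y).P = x.P - 2 * d.A₁ * d.k₂₁ := by
  rw [(d.compose_P_Q hx).1, k₂₁_def, d.hm]
  linear_combination x.P * d.bezout₁ hx

/-- `B = b₂ − 2A₂k₁₂`. [cite: Cohen1993, Alg. 5.4.7 (B ≡ b₂ mod 2a₂/d)] -/
theorem compose_P_eq₂ : (compose x y).P = y.P - 2 * d.A₂ * d.k₁₂ := by
  rw [(d.compose_P_Q hx).1, k₁₂_def, d.hm]
  linear_combination (x.P + 2 * d.m) * d.bezout₁ hx - (2 * compW x y) * d.S_mul_m hx hy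

/-- The rational part of `(b₁+√D)(b₂+√D)`: `b₁b₂ + D − (b₁ + b₂)B = k₂₂ · 4gA₁A₂`. [folklore] -/
theorem rat_part : x.P * y.P + D - (x.P + y.P) * (compose x y).P = compK x y * (4 * compG x y * d.A₁ * d.A₂) := by
  have h1 := sq_sub_eq hx
  rw [d.ha₁] at h1
  have hP := d.P_eq hx hy
  rw [d.compose_P_eq₁ hx, k₂₁_def, compK_def, d.hm]
  rw [hP] at h1 ⊢
  linear_combination (-1 : ℤ) * h1 + (4 * compG x y * d.A₁ * fc x) * d.bezout₁ hx -
    (4 * compG x y * d.A₁ * compU x y) * d.S_mul_m hx hy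

/-- **`B² − D = 4A₁A₂ · C`** with `C = k₁₂k₂₁ − g k₂₂`. [cite: Jozsa2003, §7.1 Prop. 34 (I₃ is an ideal)] -/
theorem compose_sq_sub :
    (compose x y).P ^ 2 - D = 4 * (d.A₁ * d.A₂) * (d.k₁₂ * d.k₂₁ - compG x y * compK x y) := by
  have hr := d.rat_part hx hy
  have e1 := d.compose_P_eq₁ hx
  have e2 := d.compose_P_eq₂ hx hy
  -- `B² − D = (B − b₁)(B − b₂) + (b₁+b₂)B − b₁b₂ − D`
  have : ((compose x y).P - x.P) * ((compose x y).P - y.P) = 4 * (d.A₁ * d.A₂) * (d.k₁₂ * d.k₂₁) := by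
    rw [show (compose x y).P - x.P = -(2 * d.A₁ * d.k₂₁) by linarith,
      show (compose x y).P - y.P = -(2 * d.A₂ * d.k₁₂) by linarith]
    ring
  linear_combination this - hr

end CompData

/-- The composed quotient is ideal-shaped. [cite: Jozsa2003, §7.1 Prop. 34] -/
theorem isIdealShaped_compose {x y : QuadIrr D} (hx : x.IsIdealShaped) (hy : y.IsIdealShaped) (d : CompData x y) :
    (compose x y).IsIdealShaped := by
  obtain ⟨-, hQ⟩ := d.compose_P_Q hx
  have h1 := d.A₁_pos hx
  have h2 := d.A₂_pos hx hy
  refine ⟨by rw [hQ]; positivity, ⟨d.A₁ * d.A₂, by rw [hQ]; ring⟩, ?_⟩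
  rw [d.compose_sq_sub hx hy, hQ]
  exact ⟨d.k₁₂ * d.k₂₁ - compG x y * compK x y, by ring⟩

/-! ### The lattice identity -/

/-- **Composition of the lattices**: `L(x)·L(y) = span{2g·Q₃, 2g(B + √D)}`, `(B, Q₃) = compose x y`
— i.e. `(2I₁)(2I₂) = 2g · 2I₃`, `I₁I₂ = g·(A₁A₂ℤ + ((B+√D)/2)ℤ)`. The four products of generators are
`Q₁Q₂ = g·G₁`, `Q₁(b₂+√D) = k₁₂G₁ + A₁G₂`, `Q₂(b₁+√D) = k₂₁G₁ + A₂G₂`,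
`(b₁+√D)(b₂+√D) = k₂₂G₁ + S·G₂`; conversely `G₂ = u·Q₁(b₂+√D) + v·Q₂(b₁+√D) + w·(b₁+√D)(b₂+√D)`
and `G₁ = (αA₁ + βS)·Q₁Q₂ − β(A₂·Q₁(b₂+√D) − A₁·Q₂(b₁+√D)) + γ(S·Q₂(b₁+√D) − A₂(b₁+√D)(b₂+√D))`
(`αa₁ + βb₁ + γc₁ = 1`). [cite: Jozsa2003, §7.1 Prop. 34] -/
theorem latZ_mul_latZ_compose {x y : QuadIrr D} (hx : x.IsIdealShaped) (hy : y.IsIdealShaped) (d : CompData x y) :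
    latZ x * latZ y =
      Submodule.span ℤ {(2 * compG x y * (compose x y).Q : ℝ), 2 * compG x y * ((compose x y).P + Real.sqrt D)} := by
  obtain ⟨hP, hQ⟩ := d.compose_P_Q hx
  set g := compG x y with hgdef
  have hs : Real.sqrt (D : ℝ) ^ 2 = D := sqrt_sq
  have hQ₁ : (x.Q : ℝ) = 2 * (g : ℝ) * d.A₁ := by
    have := Q_eq_two_mul_fa hx; rw [d.ha₁] at this; exact_mod_cast (by linarith : x.Q = 2 * g * d.A₁)
  have hQ₂ : (y.Q : ℝ) = 2 * (g : ℝ) * d.A₂ := by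
    have := Q_eq_two_mul_fa hy; rw [d.ha₂] at this; exact_mod_cast (by linarith : y.Q = 2 * g * d.A₂)
  have e1 : ((compose x y).P : ℝ) = x.P - 2 * d.A₁ * d.k₂₁ := by exact_mod_cast d.compose_P_eq₁ hx
  have e2 : ((compose x y).P : ℝ) = y.P - 2 * d.A₂ * d.k₁₂ := by exact_mod_cast d.compose_P_eq₂ hx hy
  have hr : (x.P : ℝ) * y.P + D - (x.P + y.P) * (compose x y).P = compK x y * (4 * g * d.A₁ * d.A₂) := by
    exact_mod_cast d.rat_part hx hy
  have hSg : (x.P : ℝ) + y.P = 2 * g * d.S := by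
    have := two_mul_compS hx hy; rw [d.hS] at this; exact_mod_cast (by linarith : x.P + y.P = 2 * g * d.S)
  have hbz : (compU x y : ℝ) * d.A₁ + compV x y * d.A₂ + compW x y * d.S = 1 := by
    exact_mod_cast d.bezout₁ hx
  have hprim : (d.α : ℝ) * (g * d.A₁) + d.β * x.P + d.γ * fc x = 1 := by
    have := d.hprim; rw [d.ha₁] at this; exact_mod_cast this
  have hSm : (d.S : ℝ) * d.m + d.A₁ * fc x = d.A₂ * fc y := by exact_mod_cast d.S_mul_m hx hy
  have hm : (y.P : ℝ) = x.P + 2 * d.m := by exact_mod_cast d.hm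
  have hPx : (x.P : ℝ) = g * d.S - d.m := by exact_mod_cast d.P_eq hx hy
  have hk12 : (d.k₁₂ : ℝ) = compV x y * d.m + compW x y * fc y := by exact_mod_cast d.k₁₂_def
  have hk21 : (d.k₂₁ : ℝ) = compW x y * fc x - compU x y * d.m := by exact_mod_cast d.k₂₁_def
  have hk22 : (compK x y : ℝ) = -(compU x y * fc y + compV x y * fc x) := by exact_mod_cast compK_def x y
  have hG₁ : (2 * (g : ℝ) * ((compose x y).Q : ℝ)) = 4 * g * d.A₁ * d.A₂ := by rw [hQ]; push_cast; ring
  set G₁ : ℝ := 2 * (g : ℝ) * ((compose x y).Q : ℝ) with hG₁def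
  set G₂ : ℝ := 2 * (g : ℝ) * (((compose x y).P : ℝ) + Real.sqrt D) with hG₂def
  -- the products of generators in terms of `G₁`, `G₂`
  have e11 : (x.Q : ℝ) * y.Q = (g : ℝ) * G₁ := by rw [hG₁, hQ₁, hQ₂]; ring
  have e12 : (x.Q : ℝ) * (y.P + Real.sqrt D) = (d.k₁₂ : ℝ) * G₁ + (d.A₁ : ℝ) * G₂ := by
    rw [hG₁, hG₂def, e2, hQ₁]; ring
  have e21 : (y.Q : ℝ) * (x.P + Real.sqrt D) = (d.k₂₁ : ℝ) * G₁ + (d.A₂ : ℝ) * G₂ := by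
    rw [hG₁, hG₂def, e1, hQ₂]; ring
  have e22 : ((x.P : ℝ) + Real.sqrt D) * (y.P + Real.sqrt D) = (compK x y : ℝ) * G₁ + (d.S : ℝ) * G₂ := by
    rw [hG₁, hG₂def]
    linear_combination hs + hr + (((compose x y).P : ℝ) + Real.sqrt D) * hSg
  -- and conversely
  have f2 : G₂ = (compU x y : ℝ) * ((x.Q : ℝ) * (y.P + Real.sqrt D)) +
      (compV x y : ℝ) * ((y.Q : ℝ) * (x.P + Real.sqrt D)) +
      (compW x y : ℝ) * (((x.P : ℝ) + Real.sqrt D) * (y.P + Real.sqrt D)) := by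
    rw [e12, e21, e22, hk12, hk21, hk22]
    linear_combination (-G₂) * hbz
  have hmG : (d.A₂ : ℝ) * ((x.Q : ℝ) * (y.P + Real.sqrt D)) - d.A₁ * ((y.Q : ℝ) * (x.P + Real.sqrt D)) = d.m * G₁ := by
    rw [e12, e21, hk12, hk21]
    linear_combination (d.m * G₁) * hbz - (compW x y * G₁) * hSm
  have hcG : (d.S : ℝ) * ((y.Q : ℝ) * (x.P + Real.sqrt D)) - d.A₂ * (((x.P : ℝ) + Real.sqrt D) * (y.P + Real.sqrt D)) =
      fc x * G₁ := by
    rw [e21, e22, hk21, hk22]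
    linear_combination (fc x * G₁) * hbz - (compU x y * G₁) * hSm
  have f1 : G₁ = ((d.α * d.A₁ + d.β * d.S : ℤ) : ℝ) * ((x.Q : ℝ) * y.Q)
      - (d.β : ℝ) * ((d.A₂ : ℝ) * ((x.Q : ℝ) * (y.P + Real.sqrt D)) - d.A₁ * ((y.Q : ℝ) * (x.P + Real.sqrt D)))
      + (d.γ : ℝ) * ((d.S : ℝ) * ((y.Q : ℝ) * (x.P + Real.sqrt D)) - d.A₂ * (((x.P : ℝ) + Real.sqrt D) * (y.P + Real.sqrt D))) := by
    rw [hmG, hcG, e11]; push_cast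
    rw [hPx] at hprim
    linear_combination (-G₁) * hprim
  -- the span computation
  unfold latZ
  rw [Submodule.span_mul_span]
  apply le_antisymm
  · rw [Submodule.span_le]
    rintro r ⟨p, hp, q, hq, rfl⟩
    dsimp only
    simp only [Set.mem_insert_iff, Set.mem_singleton_iff] at hp hq
    rw [SetLike.mem_coe, Submodule.mem_span_pair]
    rcases hp with rfl | rfl <;> rcases hq with rfl | rfl
    · exact ⟨g, 0, by rw [e11]; simp [zsmul_eq_mul]⟩
    · exact ⟨d.k₁₂, d.A₁, by rw [e12]; simp only [zsmul_eq_mul]⟩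
    · exact ⟨d.k₂₁, d.A₂, by
        rw [show ((x.P : ℝ) + Real.sqrt D) * y.Q = y.Q * (x.P + Real.sqrt D) from mul_comm _ _, e21]
        simp only [zsmul_eq_mul]⟩
    · exact ⟨compK x y, d.S, by rw [e22]; simp only [zsmul_eq_mul]⟩
  · rw [Submodule.span_le]
    have hSS : ∀ p q : ℝ, p ∈ ({(x.Q : ℝ), (x.P : ℝ) + Real.sqrt D} : Set ℝ) →
        q ∈ ({(y.Q : ℝ), (y.P : ℝ) + Real.sqrt D} : Set ℝ) →
        p * q ∈ Submodule.span ℤ (({(x.Q : ℝ), (x.P : ℝ) + Real.sqrt D} : Set ℝ) * {(y.Q : ℝ), (y.P : ℝ) + Real.sqrt D}) :=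
      fun p q hp hq => Submodule.subset_span (Set.mul_mem_mul hp hq)
    have h11 := hSS _ _ (Set.mem_insert _ _) (Set.mem_insert _ _)
    have h12 := hSS _ _ (Set.mem_insert _ _) (Set.mem_insert_of_mem _ (Set.mem_singleton _))
    have h21' := hSS _ _ (Set.mem_insert_of_mem _ (Set.mem_singleton _)) (Set.mem_insert _ _)
    have h21 : (y.Q : ℝ) * (x.P + Real.sqrt D) ∈
        Submodule.span ℤ (({(x.Q : ℝ), (x.P : ℝ) + Real.sqrt D} : Set ℝ) * {(y.Q : ℝ), (y.P : ℝ) + Real.sqrt D}) := by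
      rw [show (y.Q : ℝ) * (x.P + Real.sqrt D) = (x.P + Real.sqrt D) * y.Q from mul_comm _ _]; exact h21'
    have h22 := hSS _ _ (Set.mem_insert_of_mem _ (Set.mem_singleton _)) (Set.mem_insert_of_mem _ (Set.mem_singleton _))
    set M := Submodule.span ℤ (({(x.Q : ℝ), (x.P : ℝ) + Real.sqrt D} : Set ℝ) * {(y.Q : ℝ), (y.P : ℝ) + Real.sqrt D})
    have hmG' : (d.A₂ : ℝ) * ((x.Q : ℝ) * (y.P + Real.sqrt D)) - d.A₁ * ((y.Q : ℝ) * (x.P + Real.sqrt D)) ∈ M := by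
      refine Submodule.sub_mem _ ?_ ?_
      · simpa [zsmul_eq_mul] using Submodule.smul_mem _ d.A₂ h12
      · simpa [zsmul_eq_mul] using Submodule.smul_mem _ d.A₁ h21
    have hcG' : (d.S : ℝ) * ((y.Q : ℝ) * (x.P + Real.sqrt D)) - d.A₂ * (((x.P : ℝ) + Real.sqrt D) * (y.P + Real.sqrt D)) ∈ M := by
      refine Submodule.sub_mem _ ?_ ?_
      · simpa [zsmul_eq_mul] using Submodule.smul_mem _ d.S h21
      · simpa [zsmul_eq_mul] using Submodule.smul_mem _ d.A₂ h22
    rintro r hr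
    simp only [Set.mem_insert_iff, Set.mem_singleton_iff] at hr
    rw [SetLike.mem_coe]
    rcases hr with rfl | rfl
    · rw [f1]
      refine Submodule.add_mem _ (Submodule.sub_mem _ ?_ ?_) ?_
      · simpa [zsmul_eq_mul] using Submodule.smul_mem _ (d.α * d.A₁ + d.β * d.S) h11
      · simpa [zsmul_eq_mul] using Submodule.smul_mem _ d.β hmG'
      · simpa [zsmul_eq_mul] using Submodule.smul_mem _ d.γ hcG'
    · rw [f2]
      refine Submodule.add_mem _ (Submodule.add_mem _ ?_ ?_) ?_
      · simpa [zsmul_eq_mul] using Submodule.smul_mem _ (compU x y) h12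
      · simpa [zsmul_eq_mul] using Submodule.smul_mem _ (compV x y) h21
      · simpa [zsmul_eq_mul] using Submodule.smul_mem _ (compW x y) h22

/-! ### `J(compose x_{n₁} x_{n₂}) = g Π_{n₁} Π_{n₂} · O` -/

/-- **The module of the composition of two cycle elements**:
`J(compose x_{n₁} x_{n₂}) = g · Π_{n₁} Π_{n₂} · O` (from `L(x)L(y) = 2g·L(z)`, `L = Q·J`,
`J(x_n) = Π_n O`). [cite: Jozsa2003, §7.1 (Props. 34–35: I·J and its distance δ(I) + δ(J))] -/
theorem mem_jmod_compose_iff (hD : ¬ IsSquare D) (hD4 : D % 4 = 0 ∨ D % 4 = 1) (hF : IsFundDiscr D)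
    (n₁ n₂ : ℕ) (t : ℝ) :
    let x := step^[n₁] (principalStart D)
    let y := step^[n₂] (principalStart D)
    t ∈ jmod (compose x y) ↔ ∃ s ∈ jmod (principalStart D),
      t = compG x y * valProd (principalStart D) n₁ * valProd (principalStart D) n₂ * s := by
  intro x y
  have h0 := isPreReduced_principalStart hD hD4
  have hshx : x.IsIdealShaped := isIdealShaped_iterate hD hD4 n₁
  have hshy : y.IsIdealShaped := isIdealShaped_iterate hD hD4 n₂
  have hprim : x.IsPrimitive := isPrimitive_of_isFundDiscr hF hshx
  obtain ⟨d⟩ := exists_compData hshx hshy hprim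
  obtain ⟨hP', hQ'⟩ := d.compose_P_Q hshx
  have hLL := latZ_mul_latZ_compose hshx hshy d
  have hg := compG_pos (y := y) hshx
  have ha1 := d.A₁_pos hshx
  have ha2 := d.A₂_pos hshx hshy
  have hQx : x.Q = 2 * compG x y * d.A₁ := by have := Q_eq_two_mul_fa hshx; rw [d.ha₁] at this; linarith
  have hQy : y.Q = 2 * compG x y * d.A₂ := by have := Q_eq_two_mul_fa hshy; rw [d.ha₂] at this; linarith
  have hQx0 : x.Q ≠ 0 := hshx.1.ne'
  have hQy0 : y.Q ≠ 0 := hshy.1.ne'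
  have hQ'0 : (compose x y).Q ≠ 0 := by rw [hQ']; positivity
  have hgR : (0 : ℝ) < compG x y := by exact_mod_cast hg
  set P₁ := valProd (principalStart D) n₁ with hP₁def
  set P₂ := valProd (principalStart D) n₂ with hP₂def
  set O := jmod (principalStart D) with hO
  have hLx : ∀ l, l ∈ latZ x ↔ ∃ s ∈ O, l = x.Q * P₁ * s := by
    intro l
    rw [mem_latZ_iff_mem_jmod hQx0, mem_jmod_iterate_iff hD h0 n₁]
    have hQR : (x.Q : ℝ) ≠ 0 := by exact_mod_cast hQx0
    constructor
    · rintro ⟨s, hs, hls⟩; exact ⟨s, hs, by field_simp at hls; linarith⟩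
    · rintro ⟨s, hs, rfl⟩; exact ⟨s, hs, by rw [hP₁def]; field_simp⟩
  have hLy : ∀ l, l ∈ latZ y ↔ ∃ s ∈ O, l = y.Q * P₂ * s := by
    intro l
    rw [mem_latZ_iff_mem_jmod hQy0, mem_jmod_iterate_iff hD h0 n₂]
    have hQR : (y.Q : ℝ) ≠ 0 := by exact_mod_cast hQy0
    constructor
    · rintro ⟨s, hs, hls⟩; exact ⟨s, hs, by field_simp at hls; linarith⟩
    · rintro ⟨s, hs, rfl⟩; exact ⟨s, hs, by rw [hP₂def]; field_simp⟩
  -- `Q₁ Q₂ = g · (2gQ₃)`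
  have hQQ : (x.Q : ℝ) * y.Q = compG x y * (2 * compG x y * (compose x y).Q) := by
    rw [hQ', hQx, hQy]; push_cast; ring
  constructor
  · intro ht
    have hmem : 2 * (compG x y : ℝ) * (compose x y).Q * t ∈ latZ x * latZ y := by
      rw [hLL]
      obtain ⟨m, k, rfl⟩ := mem_jmod_iff.mp ht
      rw [Submodule.mem_span_pair]
      refine ⟨m, k, ?_⟩
      simp only [zsmul_eq_mul]
      unfold val
      have : ((compose x y).Q : ℝ) ≠ 0 := by exact_mod_cast hQ'0
      field_simp
    have hprod : ∀ u ∈ latZ x * latZ y, ∃ s ∈ O, u = (x.Q : ℝ) * y.Q * (P₁ * P₂) * s := by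
      intro u hu
      unfold latZ at hu
      rw [Submodule.span_mul_span] at hu
      refine Submodule.span_induction ?_ ?_ ?_ ?_ hu
      · rintro u ⟨l₁, hl₁, l₂, hl₂, rfl⟩
        have hl₁' : l₁ ∈ latZ x := Submodule.subset_span hl₁
        have hl₂' : l₂ ∈ latZ y := Submodule.subset_span hl₂
        obtain ⟨s₁, hs₁, rfl⟩ := (hLx l₁).mp hl₁'
        obtain ⟨s₂, hs₂, rfl⟩ := (hLy l₂).mp hl₂'
        exact ⟨s₁ * s₂, mul_mem_jmod_principalStart hD4 hs₁ hs₂, by ring⟩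
      · exact ⟨0, O.zero_mem, by ring⟩
      · rintro u v - - ⟨s₁, hs₁, rfl⟩ ⟨s₂, hs₂, rfl⟩
        exact ⟨s₁ + s₂, O.add_mem hs₁ hs₂, by ring⟩
      · rintro k u - ⟨s, hs, rfl⟩
        refine ⟨k * s, ?_, by rw [zsmul_eq_mul]; ring⟩
        have := O.zsmul_mem hs k
        rwa [zsmul_eq_mul] at this
    obtain ⟨s, hs, hs'⟩ := hprod _ hmem
    refine ⟨s, hs, ?_⟩
    have h2gQ : (2 * (compG x y : ℝ) * (compose x y).Q) ≠ 0 := by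
      have : ((compose x y).Q : ℝ) ≠ 0 := by exact_mod_cast hQ'0
      positivity
    rw [hQQ] at hs'
    exact mul_left_cancel₀ h2gQ (by rw [hs']; ring)
  · rintro ⟨s, hs, rfl⟩
    have hl₁ : (x.Q : ℝ) * P₁ ∈ latZ x := (hLx _).mpr ⟨1, by
      have := intCast_add_mul_val_mem_jmod (principalStart D) 1 0; simpa using this, by ring⟩
    have hl₂ : (y.Q : ℝ) * P₂ * s ∈ latZ y := (hLy _).mpr ⟨s, hs, rfl⟩
    have hmem := Submodule.mul_mem_mul hl₁ hl₂
    rw [hLL, Submodule.mem_span_pair] at hmem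
    obtain ⟨m, k, hmk⟩ := hmem
    simp only [zsmul_eq_mul] at hmk
    rw [mem_jmod_iff]
    refine ⟨m, k, ?_⟩
    unfold val
    have hQ'R : ((compose x y).Q : ℝ) ≠ 0 := by exact_mod_cast hQ'0
    have key : (m : ℝ) * (2 * compG x y * (compose x y).Q) + k * (2 * compG x y * ((compose x y).P + Real.sqrt D)) =
        compG x y * (2 * compG x y * (compose x y).Q) * (P₁ * P₂ * s) := by rw [hmk, ← hQQ]; ring
    have h2g : (2 * (compG x y : ℝ) * (compose x y).Q) ≠ 0 := by positivity
    field_simp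
    have := key
    field_simp at this
    linarith

/-! ### The general giant step -/

/-- **The giant step by composition** (compose two cycle elements, reduce, identify): for
`x = x_{n₁}`, `y = x_{n₂}` on the principal cycle of a fundamental discriminant, the reduced
representative `w = reduce (compose x y)` is the cycle element `x_m` for some `1 ≤ m ≤ p`, and
`Π_m · εʲ = |reduceMult (compose x y)| · g · Π_{n₁} Π_{n₂}` for some `j ∈ ℤ` — the unrolled
distance of the result is `pos n₁ + pos n₂ + log g + log|μ|` modulo the regulator.
[cite: Jozsa2003, §7.1 Prop. 35 (δ(I*J) = δ(I) + δ(J) + correction)] -/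
theorem giant_step_compose (hD : ¬ IsSquare D) (hD4 : D % 4 = 0 ∨ D % 4 = 1) (hF : IsFundDiscr D) (n₁ n₂ : ℕ) :
    let x := step^[n₁] (principalStart D)
    let y := step^[n₂] (principalStart D)
    ∃ m : ℕ, 1 ≤ m ∧ m ≤ periodLength D ∧ reduce (compose x y) = step^[m] (principalStart D) ∧
      ∃ j : ℤ, |reduceMult (compose x y)| * compG x y * valProd (principalStart D) n₁ * valProd (principalStart D) n₂ =
        valProd (principalStart D) m * fundUnit D ^ j := by
  intro x y
  have h0 := isPreReduced_principalStart hD hD4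
  have hshx : x.IsIdealShaped := isIdealShaped_iterate hD hD4 n₁
  have hshy : y.IsIdealShaped := isIdealShaped_iterate hD hD4 n₂
  have hprim : x.IsPrimitive := isPrimitive_of_isFundDiscr hF hshx
  obtain ⟨d⟩ := exists_compData hshx hshy hprim
  have hsh' : (compose x y).IsIdealShaped := isIdealShaped_compose hshx hshy d
  have hadm' := hsh'.isAdmissible
  have hQ' := hsh'.1
  have hg := compG_pos (y := y) hshx
  have hgR : (0 : ℝ) < compG x y := by exact_mod_cast hg
  have hP1 := valProd_pos hD h0 n₁
  have hP2 := valProd_pos hD h0 n₂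
  set μ := reduceMult (compose x y) with hμ
  have hμ0 : μ ≠ 0 := reduceMult_ne_zero hD hadm' hQ'
  set κ := |μ| * compG x y * valProd (principalStart D) n₁ * valProd (principalStart D) n₂ with hκ
  have hκ0 : 0 < κ := by positivity
  have hκQ : IsQD D κ := by
    have hμQ : IsQD D |μ| := by
      rcases le_or_gt 0 μ with h | h
      · rw [abs_of_nonneg h]; exact isQD_gaussMult _ _
      · rw [abs_of_neg h]; exact (isQD_gaussMult _ _).neg
    exact ((hμQ.mul (IsQD.intCast (compG x y))).mul (isQD_valProd _ n₁)).mul (isQD_valProd _ n₂)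
  have hJ : ∀ t, t ∈ jmod (reduce (compose x y)) ↔ ∃ s ∈ jmod (principalStart D), t = κ * s := by
    intro t
    rw [mem_jmod_reduce_iff hD hadm' hQ' t]
    constructor
    · rintro ⟨s, hs, rfl⟩
      obtain ⟨s', hs', rfl⟩ := (mem_jmod_compose_iff hD hD4 hF n₁ n₂ s).mp hs
      rcases le_or_gt 0 μ with h | h
      · refine ⟨s', hs', ?_⟩; rw [hκ, abs_of_nonneg h, hμ]; ring
      · refine ⟨-s', (jmod (principalStart D)).neg_mem hs', ?_⟩; rw [hκ, abs_of_neg h, hμ]; ring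
    · rintro ⟨s', hs', rfl⟩
      rcases le_or_gt 0 μ with h | h
      · refine ⟨compG x y * valProd (principalStart D) n₁ * valProd (principalStart D) n₂ * s',
          (mem_jmod_compose_iff hD hD4 hF n₁ n₂ _).mpr ⟨s', hs', rfl⟩, ?_⟩
        rw [hκ, abs_of_nonneg h, hμ]; ring
      · refine ⟨compG x y * valProd (principalStart D) n₁ * valProd (principalStart D) n₂ * (-s'),
          (mem_jmod_compose_iff hD hD4 hF n₁ n₂ _).mpr ⟨-s', (jmod (principalStart D)).neg_mem hs', rfl⟩, ?_⟩
        rw [hκ, abs_of_neg h, hμ]; ring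
  obtain ⟨m, hm1, hmp, hw, j, hj⟩ :=
    exists_iterate_eq_of_jmod_eq_smul hD hD4 (isReduced_reduce hD hadm' hQ') hκ0 hκQ hJ
  exact ⟨m, hm1, hmp, hw, j, hj⟩

end QuadIrr

end Literature.NumberTheory.QuadraticFields

end
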